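import Summits.HodgeConjecture.CorCM.TwoSheetAnnihilator
import Summits.HodgeConjecture.CorCM.CyclicHalfOddCharacterSums
import Mathlib.GroupTheory.SpecificGroups.Quaternion
import HarnessLib

/-!
# The two-sheet model of `Q₈ × C_p`: odd character sums are NORM FORMS `X² + Y²` over `ℚ(ζ_p)`

COR-CM (cell `pub-hodgecm2`), binder seat b04 (gen 25), count-neutral claim QUATERNION-CYCLIC-PRIME, part I (the
group-theoretic core; part II `CorCM/GaloisQuaternionCyclicPrimeNondegenerate` is the theorem on CM fields, part III
`CorCM/CyclotomicFieldSumOfTwoSquares` the arithmetic input, part IV the unconditional classification for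
`ord_p(2)` odd).  KERNEL ONLY: theorems; no definition, no named fact, no `sorry`.  `HC_CM` is neither used nor claimed.

SETTING.  `G₀ = Q₈ × C_p` (`QuaternionGroup 2 × Multiplicative (ZMod p)`, `p` an odd prime) with its unique involution
`c₀ = (a 2, 1)` (central).  The abelian subgroup `A = ⟨a⟩ × C_p ≅ ℤ/4 × ℤ/p` (cyclic of order `4p`, generator
`γ = (1, 1)`) has index two: `G₀ = i(A) ⊔ i(A)·x`, `x = (xa 0, 1)`, `x i(u, v) x⁻¹ = i(u⁻¹, v)` (`θ` = inversion on the
`ℤ/4`-factor), `x² = c₀ = i(c)`, `c = (2, 0)`.  By gen 20's TWO-SHEET ANNIHILATOR THEOREM (`CorCM/TwoSheetAnnihilator`) a CM set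
`S ⊆ G₀` is nondegenerate as soon as, for every ODD character `χ = ψ ⊗ λ` of `A` (`ψ(2) = -1`, i.e. `ω = ψ(1)` with
`ω² = -1`), `Δ(χ) = Ŝ₁(χ)Ŝ₁(χθ) + Ŝ₂(χ)Ŝ₂(χθ) ≠ 0` (`χ(c) = -1`).  THE POINT OF THIS FILE: writing `χ(u, v) = x + ω y` with
`x, y ∈ {0, ±λ(v)}` gives, for every finite `T ⊆ A`, `Ŝ_T(χ) = X + ω Y` and `Ŝ_T(χθ) = X − ω Y` with `X, Y` in ANY subfield
`E ⊆ ℂ` containing the `p`-th roots of unity, whence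
  `Δ(χ) = (X₁² + Y₁²) + (X₂² + Y₂²)` — a sum of two NORMS `N_{E(ω)/E}`.
If `−1` is NOT a sum of two squares in `E` (for `E = ℚ(ζ_p)`: iff `ord_p(2)` is odd, part III), `Δ(χ) = 0` forces
`X₁ = Y₁ = X₂ = Y₂ = 0`, so BOTH `Ŝ₁(χ) = Ŝ₂(χ) = 0`, and gen 20's cyclic lemma (`CyclicTwoPower.mul_pow_mem_iff_of_sum_eq_zero`,
order `4p = 2²·p`) makes both sheets `C_p`-periodic: `S` has the LEFT STABILISER `(1, 4) ≠ 1` — the type is imprimitive.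

* §1 `eq_zero_of_sq_add_sq_eq_zero`, `eq_zero_of_four_squares` — in a subfield `E ⊆ ℂ` where `−1` is not a sum of two
  squares, `x₁² + y₁² + x₂² + y₂² = 0` forces all four to vanish (Brahmagupta–Fibonacci identity).
* §2 `character_normForm_single`, `sum_character_normForm`, `sums_eq_zero_of_det_eq_zero` — the norm form of odd
  characters of `ℤ/4 × ℤ/p` and the vanishing of both sheet sums when `Δ(χ) = 0`.
* §3 `orderOf_gamma`, `mem_powers_gamma` — `A` is cyclic of order `2²·p`.
* §4 **`eq_zero_of_annihilated_quaternion_cyclic`** — the model theorem: if `S ⊆ Q₈ × C_p` is a CM set without the left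
  stabiliser `(1, 4)`, every `c₀`-antisymmetric weight annihilated by the right translates of `S` vanishes (the input of
  gen 20's ANNIHILATOR CRITERION `GaloisRank.isNondegenerate_iff_forall_annihilator`).

## References

* [Kubota1965] T. Kubota, *On the field extension by complex multiplication*, Trans. AMS 118 (1965), §4 Lemma 2.
* [Dodson1984] B. Dodson, *The structure of Galois groups of CM-fields*, Trans. AMS 283 (1984), §3.1, §5.3.
* [Gordon1999HodgeAVSurvey] B. B. Gordon, *A survey of the Hodge conjecture for abelian varieties*, Prop. 9.4.1, §9.4.
-/

noncomputable section

open scoped BigOperators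

namespace Summit.HodgeConjecture.CorCM.GaloisQuaternionCyclic

open Literature.NumberTheory.ComplexMultiplication (IsCMTypeWith)
open Summit.HodgeConjecture.CorCM.CyclicTwoPower (mul_pow_mem_iff_of_sum_eq_zero)
open QuaternionGroup AddChar

/-! ## §1 Subfields of `ℂ` in which `-1` is not a sum of two squares -/

section Squares

variable (E : Subfield ℂ) (hE : ∀ x ∈ E, ∀ y ∈ E, x ^ 2 + y ^ 2 ≠ -1)
include hE

/-- `x² + y² = 0` with `x, y ∈ E` forces `x = y = 0` (else `(x/y)² + 0² = -1`). [folklore] -/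
theorem eq_zero_of_sq_add_sq_eq_zero {x y : ℂ} (hx : x ∈ E) (hy : y ∈ E) (h : x ^ 2 + y ^ 2 = 0) :
    x = 0 ∧ y = 0 := by
  by_cases hy0 : y = 0
  · subst hy0
    refine ⟨?_, rfl⟩
    simpa using h
  · exfalso
    refine hE (x / y) (E.div_mem hx hy) 0 E.zero_mem ?_
    rw [div_pow, zero_pow two_ne_zero, add_zero, div_eq_iff (pow_ne_zero 2 hy0)]
    linear_combination h

/-- **Four squares.**  `x₁² + y₁² + x₂² + y₂² = 0` with all four in `E` forces `x₁ = y₁ = x₂ = y₂ = 0`: otherwise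
`(x₁² + y₁²)/(x₂² + y₂²) = -1` is again a sum of two squares by the Brahmagupta–Fibonacci identity
`(x₁² + y₁²)(x₂² + y₂²) = (x₁x₂ + y₁y₂)² + (x₁y₂ − y₁x₂)²`. [folklore] -/
theorem eq_zero_of_four_squares {x₁ y₁ x₂ y₂ : ℂ} (hx₁ : x₁ ∈ E) (hy₁ : y₁ ∈ E) (hx₂ : x₂ ∈ E) (hy₂ : y₂ ∈ E)
    (h : x₁ ^ 2 + y₁ ^ 2 + (x₂ ^ 2 + y₂ ^ 2) = 0) : x₁ = 0 ∧ y₁ = 0 ∧ x₂ = 0 ∧ y₂ = 0 := by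
  by_cases h2 : x₂ ^ 2 + y₂ ^ 2 = 0
  · obtain ⟨rfl, rfl⟩ := eq_zero_of_sq_add_sq_eq_zero E hE hx₂ hy₂ h2
    have h1 : x₁ ^ 2 + y₁ ^ 2 = 0 := by simpa using h
    obtain ⟨rfl, rfl⟩ := eq_zero_of_sq_add_sq_eq_zero E hE hx₁ hy₁ h1
    simp
  · exfalso
    have hn : x₂ ^ 2 + y₂ ^ 2 ∈ E := E.add_mem (E.pow_mem hx₂ 2) (E.pow_mem hy₂ 2)
    refine hE ((x₁ * x₂ + y₁ * y₂) / (x₂ ^ 2 + y₂ ^ 2)) ?_ ((x₁ * y₂ - y₁ * x₂) / (x₂ ^ 2 + y₂ ^ 2)) ?_ ?_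
    · exact E.div_mem (E.add_mem (E.mul_mem hx₁ hx₂) (E.mul_mem hy₁ hy₂)) hn
    · exact E.div_mem (E.sub_mem (E.mul_mem hx₁ hy₂) (E.mul_mem hy₁ hx₂)) hn
    · rw [div_pow, div_pow, ← add_div, div_eq_iff (pow_ne_zero 2 h2)]
      linear_combination (x₂ ^ 2 + y₂ ^ 2) * h

end Squares

/-! ## §2 The norm form of odd characters of `ℤ/4 × ℤ/p` -/

section NormForm

variable {p : ℕ}

/-- `(1,1)·(1,1) = (2,1)` in `ℤ/4 × ℤ/p` (first factor written additively as `ZMod (2*2)`). [folklore] -/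
theorem gen_mul_gen : ((Multiplicative.ofAdd (1 : ZMod (2 * 2)), (1 : Multiplicative (ZMod p))) *
      (Multiplicative.ofAdd (1 : ZMod (2 * 2)), (1 : Multiplicative (ZMod p))) :
        Multiplicative (ZMod (2 * 2)) × Multiplicative (ZMod p)) = (Multiplicative.ofAdd 2, 1) := by
  rw [Prod.mk_mul_mk, mul_one, ← ofAdd_add]
  norm_num

variable (χ : AddChar (Additive (Multiplicative (ZMod (2 * 2)) × Multiplicative (ZMod p))) ℂ)
  (hχ : χ (Additive.ofMul (Multiplicative.ofAdd (2 : ZMod (2 * 2)), (1 : Multiplicative (ZMod p)))) = -1)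
include hχ

/-- For an ODD character `χ` (`χ(2, 0) = -1`), `ω = χ(1, 0)` has `ω² = -1`. [folklore] -/
theorem omega_mul_omega : χ (Additive.ofMul (Multiplicative.ofAdd (1 : ZMod (2 * 2)), (1 : Multiplicative (ZMod p)))) *
    χ (Additive.ofMul (Multiplicative.ofAdd (1 : ZMod (2 * 2)), (1 : Multiplicative (ZMod p)))) = -1 := by
  rw [← map_add_eq_mul, ← ofMul_mul, gen_mul_gen, hχ]

/-- **The norm form, one element at a time.**  For `w = (u, v) ∈ ℤ/4 × ℤ/p` and an odd character `χ` with
`ω = χ(1, 0)`: `χ(u, v) = x + ω y` and `χ(u⁻¹, v) = x − ω y` with `x, y ∈ {0, ±χ(0, v)}` — in particular in any subfield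
`E ⊆ ℂ` containing the `p`-th roots of unity. [folklore] -/
theorem character_normForm_single (E : Subfield ℂ) (hEμ : ∀ z : ℂ, z ^ p = 1 → z ∈ E)
    (w : Multiplicative (ZMod (2 * 2)) × Multiplicative (ZMod p)) :
    ∃ x y : ℂ, x ∈ E ∧ y ∈ E ∧
      χ (Additive.ofMul w) =
        x + χ (Additive.ofMul (Multiplicative.ofAdd (1 : ZMod (2 * 2)), (1 : Multiplicative (ZMod p)))) * y ∧
      χ (Additive.ofMul (w.1⁻¹, w.2)) =
        x - χ (Additive.ofMul (Multiplicative.ofAdd (1 : ZMod (2 * 2)), (1 : Multiplicative (ZMod p)))) * y := by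
  set ω : ℂ := χ (Additive.ofMul (Multiplicative.ofAdd (1 : ZMod (2 * 2)), (1 : Multiplicative (ZMod p))))
    with hω_def
  have hωω : ω * ω = -1 := omega_mul_omega χ hχ
  obtain ⟨u, v⟩ := w
  -- the `C_p`-part `ℓ = χ(0, v)` is a `p`-th root of unity
  set ℓ : ℂ := χ (Additive.ofMul ((1 : Multiplicative (ZMod (2 * 2))), v)) with hℓ_def
  have hℓp : ℓ ^ p = 1 := by
    rw [hℓ_def, ← map_nsmul_eq_pow, ← ofMul_pow, Prod.pow_mk, one_pow]
    have hv : v ^ p = 1 := by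
      rw [← ofAdd_toAdd v, ← ofAdd_nsmul, nsmul_eq_mul, ZMod.natCast_self, zero_mul]; rfl
    rw [hv, ← Prod.one_eq_mk, ofMul_one, map_zero_eq_one]
  have hℓE : ℓ ∈ E := hEμ ℓ hℓp
  -- `u = 1^k`, `k < 4`
  obtain ⟨k, hk4, rfl⟩ : ∃ k : ℕ, k < 4 ∧ u = Multiplicative.ofAdd (1 : ZMod (2 * 2)) ^ k := by
    refine ⟨(Multiplicative.toAdd u).val, ZMod.val_lt _, ?_⟩
    rw [← ofAdd_nsmul, nsmul_eq_mul, mul_one, ZMod.natCast_zmod_val]; rfl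
  -- `χ(1^k, v) = ω^k ℓ`, `χ(1^{-k}, v) = ω^{-k} ℓ`
  have hsplit : ∀ t : Multiplicative (ZMod (2 * 2)),
      χ (Additive.ofMul (t, v)) = χ (Additive.ofMul (t, (1 : Multiplicative (ZMod p)))) * ℓ := fun t => by
    rw [hℓ_def, ← map_add_eq_mul, ← ofMul_mul, Prod.mk_mul_mk, mul_one, one_mul]
  have hpow : χ (Additive.ofMul (Multiplicative.ofAdd (1 : ZMod (2 * 2)) ^ k, (1 : Multiplicative (ZMod p)))) =
      ω ^ k := by
    rw [hω_def, ← map_nsmul_eq_pow, ← ofMul_pow, Prod.pow_mk, one_pow]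
  have hinv : χ (Additive.ofMul ((Multiplicative.ofAdd (1 : ZMod (2 * 2)) ^ k)⁻¹, (1 : Multiplicative (ZMod p)))) =
      (ω ^ k)⁻¹ := by
    rw [← hpow, ← map_neg_eq_inv, ← ofMul_inv, Prod.inv_mk, inv_one]
  have hωinv : ω⁻¹ = -ω := inv_eq_of_mul_eq_one_right (by rw [mul_neg, hωω, neg_neg])
  rw [hsplit, hsplit, hpow, hinv, ← inv_pow, hωinv]
  interval_cases k
  · exact ⟨ℓ, 0, hℓE, E.zero_mem, by linear_combination, by linear_combination⟩
  · exact ⟨0, ℓ, E.zero_mem, hℓE, by linear_combination, by linear_combination⟩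
  · exact ⟨-ℓ, 0, E.neg_mem hℓE, E.zero_mem, by linear_combination ℓ * hωω, by linear_combination ℓ * hωω⟩
  · exact ⟨0, -ℓ, E.zero_mem, E.neg_mem hℓE, by linear_combination ω * ℓ * hωω,
      by linear_combination -ω * ℓ * hωω⟩

/-- **The norm form of a character sum.**  For every finite `T ⊆ ℤ/4 × ℤ/p` and odd `χ`: `Σ_T χ = X + ω Y` and
`Σ_T χ∘θ = X − ω Y` (`θ(u, v) = (u⁻¹, v)`) with `X, Y ∈ E`. [cite: Kubota1965, §4 Lemma 2] -/
theorem sum_character_normForm (E : Subfield ℂ) (hEμ : ∀ z : ℂ, z ^ p = 1 → z ∈ E)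
    (T : Finset (Multiplicative (ZMod (2 * 2)) × Multiplicative (ZMod p))) :
    ∃ X Y : ℂ, X ∈ E ∧ Y ∈ E ∧
      ∑ w ∈ T, χ (Additive.ofMul w) =
        X + χ (Additive.ofMul (Multiplicative.ofAdd (1 : ZMod (2 * 2)), (1 : Multiplicative (ZMod p)))) * Y ∧
      ∑ w ∈ T, χ (Additive.ofMul (w.1⁻¹, w.2)) =
        X - χ (Additive.ofMul (Multiplicative.ofAdd (1 : ZMod (2 * 2)), (1 : Multiplicative (ZMod p)))) * Y := by
  choose fx fy hxE hyE hf hfθ using character_normForm_single χ hχ E hEμ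
  refine ⟨∑ w ∈ T, fx w, ∑ w ∈ T, fy w, sum_mem fun w _ => hxE w, sum_mem fun w _ => hyE w, ?_, ?_⟩
  · rw [Finset.sum_congr rfl fun w _ => hf w, Finset.sum_add_distrib, Finset.mul_sum]
  · rw [Finset.sum_congr rfl fun w _ => hfθ w, Finset.sum_sub_distrib, Finset.mul_sum]

/-- **`Δ(χ) = 0` kills both sheet sums.**  If `−1` is not a sum of two squares in a subfield `E ⊆ ℂ` containing the
`p`-th roots of unity, then `Ŝ₁(χ)Ŝ₁(χθ) + Ŝ₂(χ)Ŝ₂(χθ) = (X₁² + Y₁²) + (X₂² + Y₂²) = 0` forces `Ŝ₁(χ) = Ŝ₂(χ) = 0`.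
[cite: Kubota1965, §4 Lemma 2] -/
theorem sums_eq_zero_of_det_eq_zero (E : Subfield ℂ) (hEμ : ∀ z : ℂ, z ^ p = 1 → z ∈ E)
    (hE : ∀ x ∈ E, ∀ y ∈ E, x ^ 2 + y ^ 2 ≠ -1)
    (S₁ S₂ : Finset (Multiplicative (ZMod (2 * 2)) × Multiplicative (ZMod p)))
    (hΔ : (∑ s ∈ S₁, χ (Additive.ofMul s)) * (∑ s ∈ S₁, χ (Additive.ofMul (s.1⁻¹, s.2))) +
      (∑ t ∈ S₂, χ (Additive.ofMul t)) * (∑ t ∈ S₂, χ (Additive.ofMul (t.1⁻¹, t.2))) = 0) :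
    ∑ s ∈ S₁, χ (Additive.ofMul s) = 0 ∧ ∑ t ∈ S₂, χ (Additive.ofMul t) = 0 := by
  obtain ⟨X₁, Y₁, hX₁, hY₁, h1, h1θ⟩ := sum_character_normForm χ hχ E hEμ S₁
  obtain ⟨X₂, Y₂, hX₂, hY₂, h2, h2θ⟩ := sum_character_normForm χ hχ E hEμ S₂
  have hωω := omega_mul_omega χ hχ
  rw [h1, h1θ, h2, h2θ] at hΔ
  have h4 : X₁ ^ 2 + Y₁ ^ 2 + (X₂ ^ 2 + Y₂ ^ 2) = 0 := by
    linear_combination hΔ + (Y₁ ^ 2 + Y₂ ^ 2) * hωω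
  obtain ⟨rfl, rfl, rfl, rfl⟩ := eq_zero_of_four_squares E hE hX₁ hY₁ hX₂ hY₂ h4
  rw [h1, h2]
  simp

end NormForm

/-! ## §3 `ℤ/4 × ℤ/p` is cyclic of order `2²·p` -/

section Cyclic

variable {p : ℕ} [Fact p.Prime]

/-- `(1, 1)` has order `2² · p` in `ℤ/4 × ℤ/p` (`p` an odd prime). [folklore] -/
theorem orderOf_gamma (hp2 : p ≠ 2) :
    orderOf ((Multiplicative.ofAdd (1 : ZMod (2 * 2)), Multiplicative.ofAdd (1 : ZMod p)) :
      Multiplicative (ZMod (2 * 2)) × Multiplicative (ZMod p)) = 2 ^ (1 + 1) * p := by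
  have hp : p.Prime := Fact.out
  rw [Prod.orderOf_mk, orderOf_ofAdd_eq_addOrderOf, orderOf_ofAdd_eq_addOrderOf, ZMod.addOrderOf_one,
    ZMod.addOrderOf_one]
  have hcop : Nat.Coprime (2 * 2) p := by
    rw [show 2 * 2 = 2 ^ 2 by norm_num]
    exact Nat.Coprime.pow_left _ ((Nat.coprime_primes Nat.prime_two hp).2 (Ne.symm hp2))
  rw [hcop.lcm_eq_mul]
  norm_num

/-- Every element of `ℤ/4 × ℤ/p` is a power of `(1, 1)`. [folklore] -/
theorem mem_powers_gamma (hp2 : p ≠ 2) (w : Multiplicative (ZMod (2 * 2)) × Multiplicative (ZMod p)) :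
    w ∈ Submonoid.powers ((Multiplicative.ofAdd (1 : ZMod (2 * 2)), Multiplicative.ofAdd (1 : ZMod p)) :
      Multiplicative (ZMod (2 * 2)) × Multiplicative (ZMod p)) := by
  have hp : p.Prime := Fact.out
  haveI : NeZero p := ⟨hp.ne_zero⟩
  have htop : Subgroup.zpowers ((Multiplicative.ofAdd (1 : ZMod (2 * 2)), Multiplicative.ofAdd (1 : ZMod p)) :
      Multiplicative (ZMod (2 * 2)) × Multiplicative (ZMod p)) = ⊤ := by
    apply Subgroup.eq_top_of_card_eq
    rw [Nat.card_zpowers, orderOf_gamma hp2, Nat.card_eq_fintype_card, Fintype.card_prod,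
      Fintype.card_multiplicative, Fintype.card_multiplicative, ZMod.card, ZMod.card]
    norm_num
  rw [mem_powers_iff_mem_zpowers, htop]
  exact Subgroup.mem_top w

end Cyclic

/-! ## §4 The two-sheet model of `Q₈ × C_p` -/

section Model

variable {p : ℕ} [Fact p.Prime]

/-- **THE MODEL THEOREM.**  `p` an odd prime, `E ⊆ ℂ` a subfield containing the `p`-th roots of unity in which `−1` is
NOT a sum of two squares.  If `S ⊆ Q₈ × C_p` is a CM set for `c₀ = (a 2, 1)` (`c₀ y ∈ S ↔ y ∉ S`) and `(1, 4)` is not a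
left stabiliser of `S`, then every `c₀`-antisymmetric `b : Q₈ × C_p → ℚ` annihilated by all right translates of `S`
(`Σ_{s ∈ S} b(s g) = 0`) is zero.  (Two-sheet determinant `(X₁² + Y₁²) + (X₂² + Y₂²)`, §2; both sheets
`C_p`-periodic by the cyclic lemma of order `2²·p`, §3.) [cite: Kubota1965, §4 Lemma 2] [cite: Dodson1984, §5.3] -/
theorem eq_zero_of_annihilated_quaternion_cyclic (hp2 : p ≠ 2) (E : Subfield ℂ)
    (hEμ : ∀ z : ℂ, z ^ p = 1 → z ∈ E) (hE : ∀ x ∈ E, ∀ y ∈ E, x ^ 2 + y ^ 2 ≠ -1)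
    (S : Finset (QuaternionGroup 2 × Multiplicative (ZMod p)))
    (hScm : ∀ y : QuaternionGroup 2 × Multiplicative (ZMod p), (a 2, 1) * y ∈ S ↔ y ∉ S)
    (hstab : ¬ ∀ w : QuaternionGroup 2 × Multiplicative (ZMod p),
      w ∈ S ↔ ((1 : QuaternionGroup 2), Multiplicative.ofAdd (4 : ZMod p)) * w ∈ S)
    (b : QuaternionGroup 2 × Multiplicative (ZMod p) → ℚ) (hb : ∀ g, b ((a 2, 1) * g) = -b g)
    (hann : ∀ g, ∑ s ∈ S, b (s * g) = 0) : b = 0 := by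
  classical
  have hp : p.Prime := Fact.out
  haveI : NeZero p := ⟨hp.ne_zero⟩
  -- the abelian subgroup `⟨a⟩ × C_p ≅ ℤ/4 × ℤ/p`
  let i₁ : Multiplicative (ZMod (2 * 2)) →* QuaternionGroup 2 :=
    MonoidHom.mk' (fun u => a (Multiplicative.toAdd u)) fun u v => by simp [toAdd_mul]
  let i : Multiplicative (ZMod (2 * 2)) × Multiplicative (ZMod p) →* QuaternionGroup 2 × Multiplicative (ZMod p) :=
    MonoidHom.prodMap i₁ (MonoidHom.id _)
  have hi_apply : ∀ u v, i (u, v) = (a (Multiplicative.toAdd u), v) := fun u v => rfl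
  have hi : Function.Injective i := by
    rintro ⟨u, v⟩ ⟨u', v'⟩ h
    simp only [hi_apply, Prod.mk.injEq, a.injEq] at h
    exact Prod.ext (by simpa using h.1) h.2
  -- the second sheet `i(A) · x`, `x = (xa 0, 1)`
  have hx : ∀ w, i w ≠ (xa 0, 1) := fun ⟨u, v⟩ => by simp [hi_apply]
  have hcov : ∀ g : QuaternionGroup 2 × Multiplicative (ZMod p), (∃ w, g = i w) ∨ (∃ w, g = i w * (xa 0, 1)) := by
    rintro ⟨j | j, v⟩
    · exact Or.inl ⟨(Multiplicative.ofAdd j, v), by simp [hi_apply]⟩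
    · exact Or.inr ⟨(Multiplicative.ofAdd (-j), v), by simp [hi_apply]⟩
  -- conjugation by `x` inverts the `ℤ/4`-factor; `x² = c₀ = i(c)`, `c = (2, 0)`
  let θ : Multiplicative (ZMod (2 * 2)) × Multiplicative (ZMod p) ≃*
      Multiplicative (ZMod (2 * 2)) × Multiplicative (ZMod p) :=
    MulEquiv.prodCongr (MulEquiv.inv _) (MulEquiv.refl _)
  have hθ_apply : ∀ w, θ w = (w.1⁻¹, w.2) := fun w => rfl
  have hθ : ∀ w, ((xa 0, 1) : QuaternionGroup 2 × Multiplicative (ZMod p)) * i w = i (θ w) * (xa 0, 1) :=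
    fun ⟨u, v⟩ => by simp [hi_apply, hθ_apply]
  set c : Multiplicative (ZMod (2 * 2)) × Multiplicative (ZMod p) := (Multiplicative.ofAdd 2, 1) with hc_def
  have hic : i c = (a 2, 1) := rfl
  have hxx : ((xa 0, 1) : QuaternionGroup 2 × Multiplicative (ZMod p)) * (xa 0, 1) = i c := by
    rw [hic, Prod.mk_mul_mk, xa_mul_xa, mul_one]
    norm_num
  have h22 : (2 : ZMod (2 * 2)) + 2 = 0 := by decide
  have hcc : c * c = 1 := by
    rw [hc_def, Prod.mk_mul_mk, mul_one, ← ofAdd_add, h22]; rfl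
  have hθc : θ c = c := by
    rw [hθ_apply, hc_def]
    refine Prod.ext ?_ rfl
    change Multiplicative.ofAdd (-(2 : ZMod (2 * 2))) = Multiplicative.ofAdd 2
    rw [neg_eq_of_add_eq_zero_left h22]
  -- the two sheets of `S`
  set S₁ : Finset (Multiplicative (ZMod (2 * 2)) × Multiplicative (ZMod p)) :=
    Finset.univ.filter fun w => i w ∈ S with hS₁_def
  set S₂ : Finset (Multiplicative (ZMod (2 * 2)) × Multiplicative (ZMod p)) :=
    Finset.univ.filter fun w => i w * (xa 0, 1) ∈ S with hS₂_def
  have hS₁ : ∀ w, w ∈ S₁ ↔ i w ∈ S := fun w => by simp [hS₁_def]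
  have hS₂ : ∀ w, w ∈ S₂ ↔ i w * (xa 0, 1) ∈ S := fun w => by simp [hS₂_def]
  have hS₁cm : IsCMTypeWith c (↑S₁ : Set (Multiplicative (ZMod (2 * 2)) × Multiplicative (ZMod p))) := by
    refine ⟨fun w => ?_, fun g w => ?_, fun w => ?_⟩
    · rw [Finset.mem_coe, Finset.mem_coe, hS₁, hS₁, smul_eq_mul, map_mul, hic, hScm, not_not]
    · simp only [smul_eq_mul, mul_left_comm]
    · rw [smul_eq_mul, smul_eq_mul, ← mul_assoc, hcc, one_mul]
  have hS₂cm : IsCMTypeWith c (↑S₂ : Set (Multiplicative (ZMod (2 * 2)) × Multiplicative (ZMod p))) := by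
    refine ⟨fun w => ?_, fun g w => ?_, fun w => ?_⟩
    · rw [Finset.mem_coe, Finset.mem_coe, hS₂, hS₂, smul_eq_mul, map_mul, hic, mul_assoc, hScm, not_not]
    · simp only [smul_eq_mul, mul_left_comm]
    · rw [smul_eq_mul, smul_eq_mul, ← mul_assoc, hcc, one_mul]
  -- the generator `γ = (1, 1)` and the stabilising element `γ⁴ ↦ (1, 4)`
  have h4 : ((Multiplicative.ofAdd (1 : ZMod (2 * 2)), Multiplicative.ofAdd (1 : ZMod p)) :
      Multiplicative (ZMod (2 * 2)) × Multiplicative (ZMod p)) ^ 2 ^ (1 + 1) =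
      (Multiplicative.ofAdd (4 : ZMod (2 * 2)), Multiplicative.ofAdd (4 : ZMod p)) := by
    rw [Prod.pow_mk, ← ofAdd_nsmul, ← ofAdd_nsmul, nsmul_eq_mul, nsmul_eq_mul, mul_one, mul_one]
    norm_num
  have h40 : (4 : ZMod (2 * 2)) = 0 := by decide
  have hγ4 : i (((Multiplicative.ofAdd (1 : ZMod (2 * 2)), Multiplicative.ofAdd (1 : ZMod p)) :
      Multiplicative (ZMod (2 * 2)) × Multiplicative (ZMod p)) ^ 2 ^ (1 + 1)) =
      ((1 : QuaternionGroup 2), Multiplicative.ofAdd (4 : ZMod p)) := by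
    rw [h4, hi_apply, toAdd_ofAdd, h40, one_def]
  have hcomm : ∀ w, i (((Multiplicative.ofAdd (1 : ZMod (2 * 2)), Multiplicative.ofAdd (1 : ZMod p)) :
      Multiplicative (ZMod (2 * 2)) × Multiplicative (ZMod p)) ^ 2 ^ (1 + 1)) * i w =
      i (w * ((Multiplicative.ofAdd (1 : ZMod (2 * 2)), Multiplicative.ofAdd (1 : ZMod p)) :
      Multiplicative (ZMod (2 * 2)) × Multiplicative (ZMod p)) ^ 2 ^ (1 + 1)) := fun w => by
    rw [← map_mul, mul_comm w]
  -- the determinant does not vanish on odd characters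
  have hdet : ∀ χ : AddChar (Additive (Multiplicative (ZMod (2 * 2)) × Multiplicative (ZMod p))) ℂ,
      χ (Additive.ofMul c) = -1 →
      (∑ s ∈ S₁, χ (Additive.ofMul s)) * (∑ s ∈ S₁, χ (Additive.ofMul (θ s))) -
        χ (Additive.ofMul c) * ((∑ t ∈ S₂, χ (Additive.ofMul t)) * (∑ t ∈ S₂, χ (Additive.ofMul (θ t)))) ≠ 0 := by
    intro χ hχ hΔ
    simp_rw [hθ_apply] at hΔ
    rw [hχ] at hΔ
    obtain ⟨h1, h2⟩ := sums_eq_zero_of_det_eq_zero χ hχ E hEμ hE S₁ S₂ (by linear_combination hΔ)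
    have hp1 := mul_pow_mem_iff_of_sum_eq_zero (G := Multiplicative (ZMod (2 * 2)) × Multiplicative (ZMod p))
      (a := 1) (q := p) hp hp2 (orderOf_gamma hp2) (mem_powers_gamma hp2) hS₁cm χ hχ h1
    have hp2' := mul_pow_mem_iff_of_sum_eq_zero (G := Multiplicative (ZMod (2 * 2)) × Multiplicative (ZMod p))
      (a := 1) (q := p) hp hp2 (orderOf_gamma hp2) (mem_powers_gamma hp2) hS₂cm χ hχ h2
    apply hstab
    intro w
    rw [← hγ4]
    rcases hcov w with ⟨u, rfl⟩ | ⟨u, rfl⟩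
    · rw [← hS₁, hp1 u, hS₁, ← hcomm]
    · rw [← hS₂, hp2' u, hS₂, ← mul_assoc, hcomm]
  exact TwoSheet.eq_zero_of_twoSheet i hi (xa 0, 1) hx hcov θ hθ c hxx hcc hθc S S₁ S₂ hS₁ hS₂ hdet b
    (fun g => by rw [hic]; exact hb g) hann

end Model

end Summit.HodgeConjecture.CorCM.GaloisQuaternionCyclic

end
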